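import Summits.HubbardSuperconductivity.HubbardSuperconductivity.Theorems.KacWindowPenaltyWindowGapDressedReduction

/-!
# Crux `WindowGap` (stmt-HubbardSuperconductivity-1088) — line `sector-invisible-dressing`
# (payload slug `Sketch`@141959Z; idea card `Cruxes/WindowGap/Ideas/sector-invisible-dressing.md`,
# ideator sketch `Cruxes/WindowGap/SketchIdeator1.lean`) — LEAD SKELETON (continuation lead c2;
# taken over unchanged and re-registered by continuation lead c3, final lead cycle 4/4, 2026-08-16),
# FINAL FORM: everything finite-dimensional is LANDED; ONE sorry = the physics stub.
# c3 additions (negatives, --supports 1088): `Theorems/WindowGap/Negative/PairFreeConfigurations.lean`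
# (p122162) and `…/PenaltySaturation.lean` (penalty saturation: `minE(H + λW_ε | K_L) ≤ 0` for all
# real λ, ε; window excess ≤ 4(1−δ)L²; every witness has λ(Cε + a) ≤ 4(1−δ)) — see crux NOTES §11.

Line idea. `g_L(λ) := minE(H_L + λW_ε | K_L)` is unchanged if one adds to `H_L + λW_ε` any SECTOR-
INVISIBLE DRESSING `S` (zero quadratic form on `K_L = szSector N_L 0`) and relaxes the sector to the
whole Fock space: `minE(H_L + λW_ε + S | ⊤) ≤ g_L(λ)`. With `S =` chemical shift `−μ(N̂ − N_L)` +
Kac charging `k(N̂ − N_L)²` + `d`-wave pair source `−h(Δ_d + Δ_dᴴ)`, and the Cauchy–Schwarz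
domination `Re⟨φ,W_εφ⟩ ≥ (Re⟨φ,Δ_dφ⟩)²/L²` on unit vectors, a quasi-average ORDER FLOOR
`Re⟨φ, Δ_d φ⟩ ≥ m⋆L²` in the ground states `φ` of the dressed grand-canonical operator gives
`g_L(λ) ≥ minE(H_L + S | ⊤) + λ m⋆² L²`; removing the source (`≤ 8√2 h L²`) and the charging
(charged grand-canonical energy `≥ g_L(0) − B₀²/(4k)`, `B₀ = 144(2+|U|)+|μ|`) with `h = λm⋆²/64`,
`k = B²/(λm⋆²L²)`, `B ≥ B₀` leaves `g_L(λ) − g_L(0) ≥ λ(Cε + m⋆²/4)L²` once `Cε ≤ m⋆²/4`.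

LANDED (all `--supports stmt-HubbardSuperconductivity-1088`, sorry-free):
* wave-1 stubs `stub_dressingInvisible` (p117798), `stub_windowDominates` (p117547),
  `stub_sourceRemoval` (p117935), `stub_sectorLipschitz` (p117203), `stub_gcBlockFloor` (p117843) —
  `Theorems/KacWindowPenaltyWindowGapStub*.lean`;
* the composition `Theorems/KacWindowPenaltyWindowGapDressedReduction.lean` (p118901):
  `windowGap_dressedBridge`, `windowGap_dressedBookkeeping`, `windowGap_chargingFloor`,
  `windowGapAt_of_parts`, `windowGapAt_of_windowOrderAt` (ANY real `U`: dressed quasi-average order at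
  `(U,δ,μ)` ⇒ crux body at `(U,δ)`; registered sub-goal), `windowGap_of_windowOrder` (the stub below,
  verbatim as hypothesis, ⇒ `WindowGap`);
* negatives `Theorems/WindowGap/Negative/PairModesAtMomentum.lean` (p118536),
  `…/FreeWindowCalibration.lean` (p118873: `not_windowGapAt_zero` — the crux body with `U := 0` is
  false for every filling; so is the `U := 0` instance of the stub below, `…/FreeWindowOrder.lean`).

OPEN: `stub_windowOrder` — THE PHYSICS (lead): robust quasi-average `d`-wave pair amplitude of the
charged, weakly window-repelled, weakly sourced grand-canonical Hubbard torus at some `(U > 0, δ, μ)` =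
spontaneous `d`-wave symmetry breaking of the doped 2D Hubbard model in Bogoliubov–Anderson dress;
no engine in print (crux NOTES §4, §9, §10). `WindowGap_of : WindowGap` is the only theorem
concluding the crux by name; it is `windowGap_of_windowOrder stub_windowOrder`.
-/

set_option linter.dupNamespace false

noncomputable section

namespace Summit.HubbardSuperconductivity.HubbardSuperconductivity.Cruxes.WindowGap.SectorInvisibleDressing

open Matrix Literature.MathematicalPhysics.QuantumLattice
open Summit.HubbardSuperconductivity.HubbardSuperconductivity.Theorems
open Summit.HubbardSuperconductivity.HubbardSuperconductivity.Theses.KacWindowPenalty (WindowGap)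

/-- **Stub `stub_windowOrder` (THE PHYSICS; HARDEST; lead).** At some coupling `U > 0`, hole doping
`δ ∈ (0, 1/2)` and chemical potential `μ` there are an order floor `m⋆ > 0`, a charging constant
`B ≥ 144(2+|U|) + |μ|` and `ε₁ > 0` such that for every window radius `ε ∈ (0, ε₁]` some penalty
`λ > 0` makes, eventually in even `L`, EVERY unit ground state `φ` (whole Fock space) of the dressed
grand-canonical torus `H_L + λW_ε − μ(N̂ − N_L) + (B²/(λm⋆²L²))(N̂ − N_L)² − (λm⋆²/64)(Δ_d + Δ_dᴴ)`
carry `d`-wave pair amplitude `Re ⟨φ, Δ_d φ⟩ ≥ m⋆ L²` (`N_L = 2⌊(1−δ)L²/2⌋`, `W_ε` the crux's Kac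
window, `Δ_d = pairField dWaveFormFactor L`). Bogoliubov quasi-average `d`-wave order of the
charged (nearly canonical), weakly sourced Hubbard torus, robust under the weak window repulsion —
spontaneous `d`-wave symmetry breaking in Anderson's dress; open. [folklore] -/
theorem stub_windowOrder :
    ∃ U : ℝ, 0 < U ∧ ∃ δ ∈ Set.Ioo (0 : ℝ) (1 / 2), ∃ μ mstar B ε₁ : ℝ,
      0 < mstar ∧ 144 * (2 + |U|) + |μ| ≤ B ∧ 0 < ε₁ ∧
      ∀ ε ∈ Set.Ioc (0 : ℝ) ε₁, ∃ lam : ℝ, 0 < lam ∧ ∃ L₀ : ℕ, ∀ (L : ℕ) [NeZero L], L₀ ≤ L → Even L →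
        ∀ φ : Fock (Orb (FermionTorus 2 L)), star φ ⬝ᵥ φ = 1 →
          (star φ ⬝ᵥ (hubbardTorus 2 L 1 U + (lam : ℂ) • (∑ m : Fin 2 → ZMod L,
              if (2 * Real.pi / (L : ℝ)) ^ 2 * (∑ i : Fin 2, (((m i).valMinAbs : ℤ) : ℝ) ^ 2) ≤ ε ^ 2
              then ((L : ℂ) ^ 2)⁻¹ • (Matrix.conjTranspose (pairFieldAt dWaveFormFactor L m) *
                pairFieldAt dWaveFormFactor L m)
              else 0) +
            (-((μ : ℂ) • ((totalNumber : Matrix (Finset (Orb (FermionTorus 2 L)))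
                (Finset (Orb (FermionTorus 2 L))) ℂ) - ((2 * ⌊(1 - δ) * (L : ℝ) ^ 2 / 2⌋₊ : ℕ) : ℂ) • 1)) +
              ((B ^ 2 / (lam * mstar ^ 2 * (L : ℝ) ^ 2) : ℝ) : ℂ) •
                (((totalNumber : Matrix (Finset (Orb (FermionTorus 2 L)))
                  (Finset (Orb (FermionTorus 2 L))) ℂ) - ((2 * ⌊(1 - δ) * (L : ℝ) ^ 2 / 2⌋₊ : ℕ) : ℂ) • 1) *
                ((totalNumber : Matrix (Finset (Orb (FermionTorus 2 L)))
                  (Finset (Orb (FermionTorus 2 L))) ℂ) - ((2 * ⌊(1 - δ) * (L : ℝ) ^ 2 / 2⌋₊ : ℕ) : ℂ) • 1)) -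
              ((lam * mstar ^ 2 / 64 : ℝ) : ℂ) •
                (pairField dWaveFormFactor L + (pairField dWaveFormFactor L)ᴴ))) *ᵥ φ).re =
            (hubbardTorus 2 L 1 U + (lam : ℂ) • (∑ m : Fin 2 → ZMod L,
              if (2 * Real.pi / (L : ℝ)) ^ 2 * (∑ i : Fin 2, (((m i).valMinAbs : ℤ) : ℝ) ^ 2) ≤ ε ^ 2
              then ((L : ℂ) ^ 2)⁻¹ • (Matrix.conjTranspose (pairFieldAt dWaveFormFactor L m) *
                pairFieldAt dWaveFormFactor L m)
              else 0) +
            (-((μ : ℂ) • ((totalNumber : Matrix (Finset (Orb (FermionTorus 2 L)))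
                (Finset (Orb (FermionTorus 2 L))) ℂ) - ((2 * ⌊(1 - δ) * (L : ℝ) ^ 2 / 2⌋₊ : ℕ) : ℂ) • 1)) +
              ((B ^ 2 / (lam * mstar ^ 2 * (L : ℝ) ^ 2) : ℝ) : ℂ) •
                (((totalNumber : Matrix (Finset (Orb (FermionTorus 2 L)))
                  (Finset (Orb (FermionTorus 2 L))) ℂ) - ((2 * ⌊(1 - δ) * (L : ℝ) ^ 2 / 2⌋₊ : ℕ) : ℂ) • 1) *
                ((totalNumber : Matrix (Finset (Orb (FermionTorus 2 L)))
                  (Finset (Orb (FermionTorus 2 L))) ℂ) - ((2 * ⌊(1 - δ) * (L : ℝ) ^ 2 / 2⌋₊ : ℕ) : ℂ) • 1)) -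
              ((lam * mstar ^ 2 / 64 : ℝ) : ℂ) •
                (pairField dWaveFormFactor L + (pairField dWaveFormFactor L)ᴴ))).minEnergyOn ⊤ →
          mstar * (L : ℝ) ^ 2 ≤ (star φ ⬝ᵥ pairField dWaveFormFactor L *ᵥ φ).re := by
  sorry

/-- **`WindowGap_of` — the line's composition** (sorry-free outside `stub_windowOrder`): the landed
reduction `windowGap_of_windowOrder` (p118901) applied to the physics stub. [folklore] -/
theorem WindowGap_of : WindowGap :=
  windowGap_of_windowOrder stub_windowOrder

end Summit.HubbardSuperconductivity.HubbardSuperconductivity.Cruxes.WindowGap.SectorInvisibleDressing
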